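import Summits.AtomisticToContinuum.Crystallization.Theorems.FrustratedLawDichotomyStrainedPatchHomValueT2Kit

/-!
# (I1) part B — soundness of the GEOMETRIC PRIMITIVES of the G5′ value leaf (`…HomValueT2Kit` §1): frame and shift constants, the lattice argument
# `p_b` (`pA`), the `B`-family argument `q_b = p_b + hcpShift + ξ` (`qB`), the direct product `y = U·q` (`yOf`), the transposed products `Uᵀy`, `UᵀU`
# (`utY`, `utU`), the tabulation `tab3`, and the identification of the leaf's label points with the `hver` sums' arguments
# (27623 `(H) HomFloor`, hcp half; decomp-a2c hand-1 g41; FINDING-hand-1-g41 §6 (R3)).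

No definitions; 0 sorry; standard axioms; no instances / notation / `#eval`.  `--supports stmt-AtomisticToContinuum-27623`.
-/

noncomputable section

namespace Summit.AtomisticToContinuum.Crystallization.Theorems.FrustratedLawDichotomyStrainedPatchHomValueT2Kit

open scoped BigOperators
open Literature.Analysis.ValidatedNumerics.Numerics
open Summit.AtomisticToContinuum.Crystallization.Theorems.ChargedEnergyGapNegative (E3)
open Summit.AtomisticToContinuum.Crystallization.Theorems.FrustratedLawDichotomyStrainedPatchHomSplit (latPt hexFrame hcpShift)
open Summit.AtomisticToContinuum.Crystallization.Theorems.FrustratedLawDichotomyStrainedPatchHomEntryGramHcp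
  (s3 s83 s23 mem_s3 mem_s83 mem_s23 mem_half hexFrame_apply₀ hexFrame_apply₁ hexFrame_apply₂ hcpShift_apply)
open Summit.AtomisticToContinuum.Crystallization.Theorems.FrustratedLawDichotomyStrainedPatchHomCurvCentreKit (mulVecFI mem_mulVecFI)
open Summit.AtomisticToContinuum.Crystallization.Theorems.FrustratedLawDichotomyStrainedPatchHomCoords (apply_eq_sum_entries)

/-! ## §1. Constants -/

/-- `fi0 ∋ 0`. [formal bookkeeping] -/
theorem mem_fi0 : FI.mem (0 : ℝ) fi0 := by simpa [fi0] using FI.mem_ofInt 0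

/-- `frameFI i a ∋ (hexFrame i) a`. [formal bookkeeping] -/
theorem mem_frameFI (i a : Fin 3) : FI.mem (hexFrame i a) (frameFI i a) := by
  have h32 : FI.mem (Real.sqrt 3 / 2) (s3.divNat 2) := by simpa using FI.mem_divNat mem_s3 (n := 2) (by norm_num)
  have h1 : FI.mem (1 : ℝ) (FI.ofInt 1) := by simpa using FI.mem_ofInt 1
  obtain rfl | rfl | rfl : i = 0 ∨ i = 1 ∨ i = 2 := by fin_cases i <;> simp
  · rw [hexFrame_apply₀]
    fin_cases a
    · simp [frameFI]; exact h1
    · simp [frameFI]; exact mem_fi0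
    · simp [frameFI]; exact mem_fi0
  · rw [hexFrame_apply₁]
    fin_cases a
    · simp [frameFI]; simpa using mem_half
    · simp [frameFI]; exact h32
    · simp [frameFI]; exact mem_fi0
  · rw [hexFrame_apply₂]
    fin_cases a
    · simp [frameFI]; exact mem_fi0
    · simp [frameFI]; exact mem_fi0
    · simp [frameFI]; simpa using mem_s83

/-- `shiftFI a ∋ hcpShift a`. [formal bookkeeping] -/
theorem mem_shiftFI (a : Fin 3) : FI.mem (hcpShift a) (shiftFI a) := by
  have h6 : FI.mem (Real.sqrt 3 / 6) (s3.divNat 6) := by simpa using FI.mem_divNat mem_s3 (n := 6) (by norm_num)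
  rw [hcpShift_apply]
  fin_cases a
  · simp [shiftFI]; simpa using mem_half
  · simp [shiftFI]; exact h6
  · simp [shiftFI]; simpa using mem_s23

/-! ## §2. The label arguments `p_b`, `q_b` and the products -/

/-- The `U`-independent lattice vector is `p_b := latPt 1 hexFrame b`, and `latPt U hexFrame b = U p_b`. [formal bookkeeping] -/
theorem latPt_eq_apply_one (U : E3 →L[ℝ] E3) (b : Fin 3 → ℤ) : latPt U hexFrame b = U (latPt (1 : E3 →L[ℝ] E3) hexFrame b) := by
  simp [latPt]

/-- ★ `pA b a ∋ (p_b)_a`. [folklore] -/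
theorem mem_pA (b : Fin 3 → ℤ) (a : Fin 3) : FI.mem ((latPt (1 : E3 →L[ℝ] E3) hexFrame b) a) (pA b a) := by
  rw [Summit.AtomisticToContinuum.Crystallization.Theorems.FrustratedLawDichotomyStrainedPatchHomForceKit.latPt_apply, Fin.sum_univ_three]
  simp only [one_apply_eq_self]
  exact FI.mem_add (FI.mem_add (FI.mem_mulInt (mem_frameFI 0 a) (b 0)) (FI.mem_mulInt (mem_frameFI 1 a) (b 1))) (FI.mem_mulInt (mem_frameFI 2 a) (b 2))

/-- ★ `qB X b a ∋ (p_b + (hcpShift + ξ))_a` for `ξ` with components in `X`. [folklore] -/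
theorem mem_qB {ξ : E3} {X : Fin 3 → FI} (hX : ∀ i, FI.mem (ξ i) (X i)) (b : Fin 3 → ℤ) (a : Fin 3) :
    FI.mem ((latPt (1 : E3 →L[ℝ] E3) hexFrame b + (hcpShift + ξ)) a) (qB X b a) := by
  have e : (latPt (1 : E3 →L[ℝ] E3) hexFrame b + (hcpShift + ξ)) a = (latPt (1 : E3 →L[ℝ] E3) hexFrame b) a + hcpShift a + ξ a := by
    simp only [PiLp.add_apply]; ring
  rw [e]
  exact FI.mem_add (FI.mem_add (mem_pA b a) (mem_shiftFI a)) (hX a)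

/-- `tab3 f` agrees with `f`. [formal bookkeeping] -/
theorem tab3_apply (f : Fin 3 → FI) (a : Fin 3) : tab3 f a = f a := by
  fin_cases a <;> simp [tab3]

/-- `yOf` is `…HomCurvCentreKit.mulVecFI`. [formal bookkeeping] -/
theorem yOf_eq_mulVecFI (E : Fin 3 × Fin 3 → FI) (q : Fin 3 → FI) (a : Fin 3) : yOf E q a = mulVecFI E q a := rfl

/-- ★ `yOf E X a ∋ (U x)_a` for `U` with entries in `E` and `x` with components in `X`. [folklore] -/
theorem mem_yOf (U : E3 →L[ℝ] E3) (x : E3) {E : Fin 3 × Fin 3 → FI} {X : Fin 3 → FI}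
    (hE : ∀ ab : Fin 3 × Fin 3, FI.mem ((U (EuclideanSpace.single ab.2 (1 : ℝ))) ab.1) (E ab)) (hX : ∀ l, FI.mem (x l) (X l)) (a : Fin 3) :
    FI.mem ((U x) a) (yOf E X a) := by
  rw [yOf_eq_mulVecFI]; exact mem_mulVecFI U x hE hX a

/-- ★ The `A`-family label point through `yOf`: `latPt U hexFrame b = U p_b`, componentwise in `yOf E (pA b)` (also through `tab3`). [folklore] -/
theorem mem_yOf_A (U : E3 →L[ℝ] E3) {E : Fin 3 × Fin 3 → FI}
    (hE : ∀ ab : Fin 3 × Fin 3, FI.mem ((U (EuclideanSpace.single ab.2 (1 : ℝ))) ab.1) (E ab)) (b : Fin 3 → ℤ) (a : Fin 3) :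
    FI.mem ((latPt U hexFrame b) a) (tab3 (yOf E (tab3 (pA b))) a) := by
  rw [tab3_apply, latPt_eq_apply_one]
  exact mem_yOf U _ hE (fun l => by rw [tab3_apply]; exact mem_pA b l) a

/-- ★ The `B`-family label point through `yOf`: `latPt U hexFrame b + U(hcpShift + ξ) = U(p_b + hcpShift + ξ)`. [folklore] -/
theorem mem_yOf_B (U : E3 →L[ℝ] E3) (ξ : E3) {E : Fin 3 × Fin 3 → FI} {X : Fin 3 → FI}
    (hE : ∀ ab : Fin 3 × Fin 3, FI.mem ((U (EuclideanSpace.single ab.2 (1 : ℝ))) ab.1) (E ab)) (hX : ∀ i, FI.mem (ξ i) (X i))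
    (b : Fin 3 → ℤ) (a : Fin 3) :
    FI.mem ((latPt U hexFrame b + U (hcpShift + ξ)) a) (tab3 (yOf E (tab3 (qB X b))) a) := by
  rw [tab3_apply, latPt_eq_apply_one, ← map_add]
  exact mem_yOf U _ hE (fun l => by rw [tab3_apply]; exact mem_qB hX b l) a

/-- ★ `utY E Y i ∋ Σ_a U_ai y_a` (the transposed product; for self-adjoint `U` this is `(U y)_i`). [folklore] -/
theorem mem_utY (U : E3 →L[ℝ] E3) {y : E3} {E : Fin 3 × Fin 3 → FI} {Y : Fin 3 → FI}
    (hE : ∀ ab : Fin 3 × Fin 3, FI.mem ((U (EuclideanSpace.single ab.2 (1 : ℝ))) ab.1) (E ab)) (hY : ∀ a, FI.mem (y a) (Y a)) (i : Fin 3) :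
    FI.mem (∑ a : Fin 3, (U (EuclideanSpace.single i (1 : ℝ))) a * y a) (utY E Y i) := by
  rw [Fin.sum_univ_three]
  exact FI.mem_add (FI.mem_add (FI.mem_mul (hE (0, i)) (hY 0)) (FI.mem_mul (hE (1, i)) (hY 1))) (FI.mem_mul (hE (2, i)) (hY 2))

/-- ★ `utU E i j ∋ Σ_a U_ai U_aj`. [folklore] -/
theorem mem_utU (U : E3 →L[ℝ] E3) {E : Fin 3 × Fin 3 → FI}
    (hE : ∀ ab : Fin 3 × Fin 3, FI.mem ((U (EuclideanSpace.single ab.2 (1 : ℝ))) ab.1) (E ab)) (i j : Fin 3) :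
    FI.mem (∑ a : Fin 3, (U (EuclideanSpace.single i (1 : ℝ))) a * (U (EuclideanSpace.single j (1 : ℝ))) a) (utU E i j) := by
  rw [Fin.sum_univ_three]
  exact FI.mem_add (FI.mem_add (FI.mem_mul (hE (0, i)) (hE (0, j))) (FI.mem_mul (hE (1, i)) (hE (1, j)))) (FI.mem_mul (hE (2, i)) (hE (2, j)))

/-- For SELF-ADJOINT `U` the transposed product is the product: `Σ_a U_ai y_a = (U y)_i`. [folklore] -/
theorem utY_real_eq_apply (U : E3 →L[ℝ] E3) (hsa : ∀ v v' : E3, inner ℝ (U v) v' = inner ℝ v (U v')) (y : E3) (i : Fin 3) :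
    ∑ a : Fin 3, (U (EuclideanSpace.single i (1 : ℝ))) a * y a = (U y) i := by
  have h1 : ∑ a : Fin 3, (U (EuclideanSpace.single i (1 : ℝ))) a * y a = inner ℝ y (U (EuclideanSpace.single i (1 : ℝ))) := by
    rw [Summit.AtomisticToContinuum.Crystallization.Theorems.FrustratedLawDichotomyStrainedPatchHomLeafCalculus.inner_eq_sum_apply]
    exact Finset.sum_congr rfl fun a _ => by ring
  rw [h1, ← hsa, EuclideanSpace.inner_single_right]
  simp

end Summit.AtomisticToContinuum.Crystallization.Theorems.FrustratedLawDichotomyStrainedPatchHomValueT2Kit
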